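import Summits.ValiantsHypothesis.ValiantsHypothesis.Theorems.LacunarySymmetroidMatrixDescartesCensusRatioWindow
import Summits.ValiantsHypothesis.ValiantsHypothesis.Theorems.LacunarySymmetroidMatrixDescartesCensusSpanTwoSector
import Summits.ValiantsHypothesis.ValiantsHypothesis.Theorems.LacunarySymmetroidMatrixDescartesLowRankSector
import Summits.ValiantsHypothesis.ValiantsHypothesis.Theorems.LacunarySymmetroidMatrixDescartesDegreeCeiling
import Summits.ValiantsHypothesis.ValiantsHypothesis.Theorems.LacunarySymmetroidMatrixDescartesOneAlternation

/-!
# `MatrixDescartes` — the RESIDUAL window: the summit follows from a `t/(t+1)` saving on the pencils no sector covers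

CONDITIONAL: proves no part of MatrixDescartes; the residual hypothesis is OPEN and implies VH by this theorem, hence
≥ summit-hard; it is the night's kernel-located map «where the crux lives», folded into ONE sufficient statement.

HONEST FRAMING.  Object-search cell `pub-symmetroid`, crux `Theses.LacunarySymmetroid.MatrixDescartes`
(ledger item `stmt-ValiantsHypothesis-18050`, route `LacunarySymmetroid`; seats `val-sym-mdr-p1` (this file, the size
window, the commuting and span-two sectors, the ratio exchange rate) and `val-sym-mdr-p2` (the low-rank sector
`lowRankSector_eventually`, the degree ceiling `mildlyLacunary_mdr` and the one-alternation rule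
`oneAlternation_realRoots` / `linearCount_absorbed`, CITED here)).  Nothing here is unconditional
about `VP ≠ VNP`; nothing bears on `DoorA26` / `DoorA34` or any census numeral.

**`valiant_of_residual` (t s : ℕ, t ≥ 1).**  `ValiantsHypothesis` follows if, for every `c`, eventually in `K`, every
`K`-term real symmetric `m × m` lacunary pencil `(d, S)` that is RESIDUAL —
* in the size window: `K^(2t+1) < (12(m+K))^(t+1)` and `m ≤ 2^((⌊log₂K⌋+c)^c)` (outside: Descartes,
  `Census.matrixDescartesRatio_subpowerSector`; resp. outside the crux's regime);
* genuinely lacunary: some exponent `d l > 2^((⌊log₂K⌋+c)^c)` (else mdr-p2's `mildlyLacunary_mdr`);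
* non-commuting: not all `S l` pairwise commute (else `Census.matrixDescartes_commutingSector`);
* of coefficient span ≥ 3: `S` is not of the form `l ↦ α l • A + β l • B` (else `Census.matrixDescartes_spanTwoSector`);
* with at least two fat letters: for every `l₀` some `l ≠ l₀` has `rank (S l) ≥ 2^s` (else mdr-p2's
  `lowRankSector_eventually`, thresholds `2^((t+1)s) ≤ K`);
* not a two-way one-alternation word: no pivots `e, e'` with `S l ⪰ 0` below `e`, `⪯ 0` above `e`, and the reflected
  letters `(−1)^(d l) S l ⪰ 0` below `e'`, `⪯ 0` above `e'` (else mdr-p2's `oneAlternation_realRoots`: `Z ≤ 2m+1`,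
  absorbed by `linearCount_absorbed`) —
satisfies `Z^(t+1) ≤ 2^(t·K⌊log₂K⌋)`.  Every excluded class satisfies that inequality by the cited kernel theorems
(each gives `Z^(t+1) ≤ 2^(K⌊log₂K⌋) ≤ 2^(t·K⌊log₂K⌋)`), so the residual hypothesis extends to all formats and
`Census.valiant_of_ratioWindow` applies.  mdr-p2's quantitative few-fat-letters condition (`fewFatLetters_mdr`) is a
compatible refinement not folded in here.

[folklore] Case analysis over the companion files; no new mathematics.
-/

-- `Summit.ValiantsHypothesis.ValiantsHypothesis.…` repeats a component by the D-0017 layout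
-- (single-conjunct summit), which the `dupNamespace` linter flags; the name is mandated.
set_option linter.dupNamespace false

namespace Summit.ValiantsHypothesis.ValiantsHypothesis.Theorems.LacunarySymmetroidMatrixDescartes.Census

open scoped BigOperators
open Polynomial

/-- `Z^(t+1) ≤ 2^(K⌊log₂K⌋)` implies the ratio form `Z^(t+1) ≤ 2^(t·K⌊log₂K⌋)` for `t ≥ 1`. [folklore] -/
theorem ratio_of_unit {Z t K : ℕ} (ht : 0 < t) (h : Z ^ (t + 1) ≤ 2 ^ (K * Nat.log 2 K)) :
    Z ^ (t + 1) ≤ 2 ^ (t * (K * Nat.log 2 K)) :=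
  h.trans (Nat.pow_le_pow_right (by norm_num) (Nat.le_mul_of_pos_left _ ht))

/-- **The summit from the residual window.**  See the module docstring: for `t ≥ 1` and any `s`, if for every `c`,
eventually in `K`, every RESIDUAL symmetric pencil (size window, genuinely lacunary, non-commuting, coefficient span
`≥ 3`, at least two letters of rank `≥ 2^s`, not a two-way one-alternation word) satisfies `Z^(t+1) ≤ 2^(t·K⌊log₂K⌋)`, then `VP ≠ VNP` over `ℂ`.  All
excluded pencils satisfy the inequality by kernel theorems of the two `val-sym-mdr` seats.  The hypothesis is OPEN
and at least summit-hard. [folklore] -/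
theorem valiant_of_residual (t s : ℕ) (ht : 0 < t)
    (h : ∀ c : ℕ, ∃ K₀ : ℕ, ∀ K m : ℕ, K₀ ≤ K → K ^ (2 * t + 1) < (12 * (m + K)) ^ (t + 1) →
      m ≤ 2 ^ ((Nat.log 2 K + c) ^ c) →
      ∀ (d : Fin K → ℕ) (S : Fin K → Matrix (Fin m) (Fin m) ℝ), (∀ l, (S l).IsSymm) →
        (∃ l, 2 ^ ((Nat.log 2 K + c) ^ c) < d l) →
        (¬ ∀ l l', S l * S l' = S l' * S l) →
        (¬ ∃ (A B : Matrix (Fin m) (Fin m) ℝ) (α β : Fin K → ℝ), ∀ l, S l = α l • A + β l • B) →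
        (∀ l₀ : Fin K, ∃ l, l ≠ l₀ ∧ 2 ^ s ≤ (S l).rank) →
        (¬ ∃ e e' : ℕ, (∀ l, d l < e → (S l).PosSemidef) ∧ (∀ l, e < d l → (-S l).PosSemidef) ∧
            (∀ l, d l < e' → (((-1 : ℝ) ^ d l) • S l).PosSemidef) ∧
            (∀ l, e' < d l → (-(((-1 : ℝ) ^ d l) • S l)).PosSemidef)) →
        (Matrix.det (∑ l, ((Polynomial.X : Polynomial ℝ) ^ d l) • (S l).map Polynomial.C)).roots.toFinset.card
            ^ (t + 1) ≤ 2 ^ (t * (K * Nat.log 2 K))) :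
    _root_.ValiantsHypothesis := by
  refine valiant_of_ratioWindow t fun c => ?_
  obtain ⟨K₀, hK₀⟩ := h c
  obtain ⟨K₁, hK₁⟩ := mildlyLacunary_mdr c (t + 1)
  obtain ⟨K₂, hK₂⟩ := matrixDescartes_commutingSector c (t + 1)
  obtain ⟨K₃, hK₃⟩ := matrixDescartes_spanTwoSector c (t + 1)
  obtain ⟨K₅, hK₅⟩ := linearCount_absorbed c (t + 1)
  obtain ⟨P, hP⟩ : ∃ P : ℕ, P = 2 ^ ((t + 1) * s) := ⟨_, rfl⟩
  refine ⟨K₀ + K₁ + K₂ + K₃ + K₅ + P, fun K m hK hwin hm d S hS => ?_⟩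
  have hK0 : K₀ ≤ K := by omega
  have hK1 : K₁ ≤ K := by omega
  have hK2 : K₂ ≤ K := by omega
  have hK3 : K₃ ≤ K := by omega
  have hK4 : 2 ^ ((t + 1) * s) ≤ K := by rw [← hP]; omega
  have hK5 : K₅ ≤ K := by omega
  -- (1) mildly lacunary pencils: degree ceiling
  by_cases hlac : ∃ l, 2 ^ ((Nat.log 2 K + c) ^ c) < d l
  swap
  · push Not at hlac
    exact ratio_of_unit ht (hK₁ K m hK1 hm d S hlac)
  -- (2) commuting coefficients
  by_cases hcomm : ∀ l l', S l * S l' = S l' * S l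
  · exact ratio_of_unit ht (hK₂ K m hK2 hm d S hS hcomm)
  -- (3) coefficient span ≤ 2
  by_cases hspan : ∃ (A B : Matrix (Fin m) (Fin m) ℝ) (α β : Fin K → ℝ), ∀ l, S l = α l • A + β l • B
  · obtain ⟨A, B, α, β, hAB⟩ := hspan
    have e : S = fun l => α l • A + β l • B := funext hAB
    subst e
    exact ratio_of_unit ht (hK₃ K m hK3 hm d A B α β)
  -- (4) all letters but one of rank < 2^s
  by_cases hfat : ∀ l₀ : Fin K, ∃ l, l ≠ l₀ ∧ 2 ^ s ≤ (S l).rank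
  swap
  · push Not at hfat
    obtain ⟨l₀, hl₀⟩ := hfat
    exact ratio_of_unit ht (lowRankSector_eventually (t + 1) s K m hK4 l₀ d S hl₀)
  -- (5) two-way one-alternation words
  by_cases halt : ∃ e e' : ℕ, (∀ l, d l < e → (S l).PosSemidef) ∧ (∀ l, e < d l → (-S l).PosSemidef) ∧
      (∀ l, d l < e' → (((-1 : ℝ) ^ d l) • S l).PosSemidef) ∧
      (∀ l, e' < d l → (-(((-1 : ℝ) ^ d l) • S l)).PosSemidef)
  · obtain ⟨e, e', hlo, hhi, hlo', hhi'⟩ := halt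
    exact ratio_of_unit ht (hK₅ K m _ hK5 hm (oneAlternation_realRoots K m e e' d S hS hlo hhi hlo' hhi'))
  -- (6) residual pencils: the hypothesis
  exact hK₀ K m hK0 hwin hm d S hS hlac hcomm hspan hfat halt

end Summit.ValiantsHypothesis.ValiantsHypothesis.Theorems.LacunarySymmetroidMatrixDescartes.Census
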